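import Summits.Ventures.PercRepro.C041PortProblemSub

/-!
# The port problem of THEOREM R: CASE (v) — the unique one-edge gate and the identity `Φ ≥ Φ′` (p6, gen 23)

Setting of `C041PortProblemSub` (mine-3, C-041.md §3 (v) / §6 (c)).  The port-free reach `R₀` has a UNIQUE gate `p`,
switchable, of type `{1}` (one 1-edge `e* = (p, false)`, no 2-edge).  A pattern `x` of `P` is a pattern `x′` of the
sub-problem `P.sub p` together with the colour `b = x e*` (`restrict` / `extend`, the equivalence `patternEquiv`).
The dictionary: with `e*` red, `Good₂ x` holds (the red gate edge, KEY FACT) and `Good₁ x ↔ Good₁′ x′`; with `e*` blue,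
`Good₁ x` fails (`R₀` has no endpoint and the only exit is deleted) and `Good₂ x ↔ Good₂′ x′`; admissibility and the
validity data `X₂` transfer, `X₁ x` holds when `e*` is red.  Summing the two colours,

  `Φ P − Φ (P.sub p) = Σ_{x′ admissible} (3·[Good₁′ x′] + 1) − Σ_{x′ admissible, valid′} 3·[Good₁′ x′] ≥ 0`

(`phiOr_sub_le`, `phiAnd_sub_le`): the paper's exact identity `Φ = N′ + Φ′` for `V_∨`, an inequality for `V_∧`.
-/

namespace PercRepro

namespace PortProblem

namespace Problem

open Finset

variable {V : Type*} [DecidableEq V] {P : Problem V} {p : V}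

/-- The 1-edge of the gate `p`. -/
def estar (hp : p ∈ P.M) (hk₁ : P.k₁ p = true) : P.Term :=
  ⟨(p, false), hp, fun _ => hk₁, fun h => Bool.noConfusion h⟩

/-- A term of the sub-problem is a term of `P`. -/
def liftTerm (P : Problem V) (p : V) (e : (P.sub p).Term) : P.Term :=
  ⟨e.1, Finset.mem_of_mem_erase e.2.1, e.2.2.1, e.2.2.2⟩

/-- The restriction of a pattern of `P` to the sub-problem. -/
def restrict (P : Problem V) (p : V) (x : P.Term → Bool) : (P.sub p).Term → Bool :=
  fun e => x (P.liftTerm p e)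

/-- The extension of a pattern of the sub-problem by the colour `b` at the gate. -/
def extend (P : Problem V) (p : V) (x' : (P.sub p).Term → Bool) (b : Bool) : P.Term → Bool :=
  fun e => if h : e.1.1 = p then b else x' ⟨e.1, Finset.mem_erase.2 ⟨h, e.2.1⟩, e.2.2.1, e.2.2.2⟩

omit [DecidableEq V] in
/-- A term of `P` at the gate `p` (which has no 2-edge) is `e*`. -/
theorem eq_estar_of_fst (hp : p ∈ P.M) (hk₁ : P.k₁ p = true) (hk₂ : P.k₂ p = false) {e : P.Term}
    (he : e.1.1 = p) : e = estar hp hk₁ := by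
  apply Subtype.ext
  have h2 : e.1.2 = false := by
    cases h : e.1.2
    · rfl
    · have := e.2.2.2 h
      rw [he] at this
      rw [this] at hk₂
      exact Bool.noConfusion hk₂
  exact Prod.ext_iff.mpr ⟨he, h2⟩

/-- The first component of a term of the sub-problem is not the gate. -/
theorem liftTerm_fst_ne (e : (P.sub p).Term) : (P.liftTerm p e).1.1 ≠ p :=
  (Finset.mem_erase.1 e.2.1).1

/-- The extension agrees with the sub-problem's pattern off the gate. -/
@[simp] theorem extend_liftTerm (x' : (P.sub p).Term → Bool) (b : Bool) (e : (P.sub p).Term) :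
    P.extend p x' b (P.liftTerm p e) = x' e := by
  unfold extend
  rw [dif_neg (liftTerm_fst_ne e)]
  rfl

/-- The extension has the colour `b` at the gate edge. -/
@[simp] theorem extend_estar (hp : p ∈ P.M) (hk₁ : P.k₁ p = true) (x' : (P.sub p).Term → Bool) (b : Bool) :
    P.extend p x' b (estar hp hk₁) = b := by
  unfold extend
  exact dif_pos rfl

/-- Restricting an extension gives the pattern back. -/
theorem restrict_extend (x' : (P.sub p).Term → Bool) (b : Bool) : P.restrict p (P.extend p x' b) = x' := by
  funext e
  exact extend_liftTerm x' b e

/-- Extending a restriction by the pattern's own gate colour gives the pattern back. -/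
theorem extend_restrict (hp : p ∈ P.M) (hk₁ : P.k₁ p = true) (hk₂ : P.k₂ p = false) (x : P.Term → Bool) :
    P.extend p (P.restrict p x) (x (estar hp hk₁)) = x := by
  funext e
  by_cases he : e.1.1 = p
  · rw [eq_estar_of_fst hp hk₁ hk₂ he, extend_estar]
  · unfold extend
    rw [dif_neg he]
    rfl

/-- **The pattern correspondence**: a pattern of `P` is a pattern of the sub-problem with a colour at the gate. -/
def patternEquiv (hp : p ∈ P.M) (hk₁ : P.k₁ p = true) (hk₂ : P.k₂ p = false) :
    (P.Term → Bool) ≃ ((P.sub p).Term → Bool) × Bool where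
  toFun x := (P.restrict p x, x (estar hp hk₁))
  invFun q := P.extend p q.1 q.2
  left_inv x := extend_restrict hp hk₁ hk₂ x
  right_inv q := by
    obtain ⟨x', b⟩ := q
    simp only [restrict_extend, extend_estar]

/-! ### Transfer of the predicates along `extend` -/

section Transfer

variable (hp : P.IsGate p) (huniq : ∀ g, P.IsGate g → g = p) (hk₁ : P.k₁ p = true)
  (hk₂ : P.k₂ p = false) (hsw : P.sw p = true)

omit [DecidableEq V] in
include hk₂ in
/-- The gate is never deleted on side `2`. -/
theorem gate_not_mem_A₂ (x : P.Term → Bool) : p ∉ P.A₂ x := not_mem_A₂_of_no_two hk₂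

include hk₂ in
/-- `A₂` transfers. -/
theorem A₂_extend (x' : (P.sub p).Term → Bool) (b : Bool) : P.A₂ (P.extend p x' b) = (P.sub p).A₂ x' := by
  ext q
  constructor
  · rintro ⟨e, he, hxe⟩
    have hne : e.1.1 ≠ p := by
      intro h
      have := e.2.2.2 (by rw [he])
      rw [h] at this
      rw [this] at hk₂
      exact Bool.noConfusion hk₂
    refine ⟨⟨e.1, Finset.mem_erase.2 ⟨hne, e.2.1⟩, e.2.2.1, e.2.2.2⟩, he, ?_⟩
    have hxe' := hxe
    unfold extend at hxe'
    rw [dif_neg hne] at hxe'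
    exact hxe'
  · rintro ⟨e, he, hxe⟩
    refine ⟨P.liftTerm p e, he, ?_⟩
    rw [extend_liftTerm]
    exact hxe

/-- `A₁` transfers off the gate. -/
theorem mem_A₁_extend_iff (x' : (P.sub p).Term → Bool) (b : Bool) {q : V} (hq : q ≠ p) :
    q ∈ P.A₁ (P.extend p x' b) ↔ q ∈ (P.sub p).A₁ x' := by
  constructor
  · rintro ⟨e, he, hxe⟩
    have hne : e.1.1 ≠ p := by
      rw [he]
      exact hq
    refine ⟨⟨e.1, Finset.mem_erase.2 ⟨hne, e.2.1⟩, e.2.2.1, e.2.2.2⟩, he, ?_⟩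
    have hxe' := hxe
    unfold extend at hxe'
    rw [dif_neg hne] at hxe'
    exact hxe'
  · rintro ⟨e, he, hxe⟩
    refine ⟨P.liftTerm p e, he, ?_⟩
    rw [extend_liftTerm]
    exact hxe

/-- With the gate edge red, the gate is not deleted on side `1`. -/
theorem gate_not_mem_A₁_of_red (x' : (P.sub p).Term → Bool) : p ∉ P.A₁ (P.extend p x' true) := by
  rintro ⟨e, he, hxe⟩
  have h1 : e.1.1 = p := by rw [he]
  unfold extend at hxe
  rw [dif_pos h1] at hxe
  exact Bool.noConfusion hxe

include hk₁ in
/-- With the gate edge blue, the gate is deleted on side `1`. -/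
theorem gate_mem_A₁_of_blue (hpM : p ∈ P.M) (x' : (P.sub p).Term → Bool) :
    p ∈ P.A₁ (P.extend p x' false) :=
  ⟨estar hpM hk₁, rfl, extend_estar hpM hk₁ x' false⟩

/-- With the gate edge red, `A₁` is the sub-problem's `A₁` (the gate is in neither). -/
theorem A₁_extend_true (x' : (P.sub p).Term → Bool) : P.A₁ (P.extend p x' true) = (P.sub p).A₁ x' := by
  ext q
  by_cases hq : q = p
  · subst hq
    constructor
    · intro h
      exact absurd h (gate_not_mem_A₁_of_red x')
    · intro h
      exact absurd (A₁_subset x' h) (fun h' => (Finset.mem_erase.1 h').1 rfl)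
  · exact mem_A₁_extend_iff x' true hq

/-- The ports of the sub-problem are outside `R₀` and are ports of `P`. -/
theorem sub_A_subset_M {A : Set V} (h : A ⊆ ↑(P.sub p).M) : A ⊆ ↑P.M :=
  fun _ hq => Finset.mem_of_mem_erase (h hq)

include hp huniq hk₂ in
/-- **`Good₁` transfers when the gate edge is red.** -/
theorem good₁_extend_true_iff (x' : (P.sub p).Term → Bool) :
    P.Good₁ (P.extend p x' true) ↔ (P.sub p).Good₁ x' := by
  rw [Good₁, Good₁, A₁_extend_true]
  constructor
  · rintro ⟨e, he, hxe, hr⟩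
    have hne : e.1.1 ≠ p := by
      intro h
      have := e.2.2.2 he
      rw [h] at this
      rw [this] at hk₂
      exact Bool.noConfusion hk₂
    refine ⟨⟨e.1, Finset.mem_erase.2 ⟨hne, e.2.1⟩, e.2.2.1, e.2.2.2⟩, he, ?_, ?_⟩
    · have hxe' := hxe
      unfold extend at hxe'
      rw [dif_neg hne] at hxe'
      exact hxe'
    · exact (reach_iff_reach_sub hp huniq (sub_A_subset_M (A₁_subset x'))
        (not_mem_R₀_of_mem_M e.2.1)).1 hr
  · rintro ⟨e, he, hxe, hr⟩
    refine ⟨P.liftTerm p e, he, ?_, ?_⟩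
    · rw [extend_liftTerm]
      exact hxe
    · exact (reach_iff_reach_sub hp huniq (sub_A_subset_M (A₁_subset x'))
        (not_mem_R₀_of_mem_M (Finset.mem_of_mem_erase e.2.1))).2 hr

include hp hk₁ hk₂ in
/-- **`Good₂` holds when the gate edge is red.** -/
theorem good₂_extend_true (x' : (P.sub p).Term → Bool) : P.Good₂ (P.extend p x' true) :=
  good₂_of_red_pure_gate (e := estar hp.mem hk₁) hp rfl hk₂ (extend_estar hp.mem hk₁ x' true)

include hp huniq hk₁ in
/-- **`Good₁` fails when the gate edge is blue.** -/
theorem not_good₁_extend_false (x' : (P.sub p).Term → Bool) : ¬ P.Good₁ (P.extend p x' false) := by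
  rintro ⟨e, _, _, hr⟩
  exact not_reach_of_gate_mem huniq (gate_mem_A₁_of_blue hk₁ hp.mem x') (not_mem_R₀_of_mem_M e.2.1) hr

include hp huniq hk₁ hk₂ in
/-- **`Good₂` transfers when the gate edge is blue.** -/
theorem good₂_extend_false_iff (x' : (P.sub p).Term → Bool) :
    P.Good₂ (P.extend p x' false) ↔ (P.sub p).Good₂ x' := by
  rw [Good₂, Good₂, A₂_extend hk₂]
  constructor
  · rintro ⟨e, he, hxe, hr⟩
    have hne : e.1.1 ≠ p := by
      intro h
      have h' : e = estar hp.mem hk₁ := eq_estar_of_fst hp.mem hk₁ hk₂ h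
      rw [h', extend_estar] at hxe
      exact Bool.noConfusion hxe
    refine ⟨⟨e.1, Finset.mem_erase.2 ⟨hne, e.2.1⟩, e.2.2.1, e.2.2.2⟩, he, ?_, ?_⟩
    · have hxe' := hxe
      unfold extend at hxe'
      rw [dif_neg hne] at hxe'
      exact hxe'
    · exact (reach_iff_reach_sub hp huniq (sub_A_subset_M (A₂_subset x'))
        (not_mem_R₀_of_mem_M e.2.1)).1 hr
  · rintro ⟨e, he, hxe, hr⟩
    refine ⟨P.liftTerm p e, he, ?_, ?_⟩
    · rw [extend_liftTerm]
      exact hxe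
    · exact (reach_iff_reach_sub hp huniq (sub_A_subset_M (A₂_subset x'))
        (not_mem_R₀_of_mem_M (Finset.mem_of_mem_erase e.2.1))).2 hr

include hk₂ in
/-- `X₂` transfers (the gate has no 2-edge). -/
theorem X₂_extend_iff (x' : (P.sub p).Term → Bool) (b : Bool) : P.X₂ (P.extend p x' b) ↔ (P.sub p).X₂ x' := by
  constructor
  · rintro ⟨e, he, hxe⟩
    have hne : e.1.1 ≠ p := by
      intro h
      have := e.2.2.2 he
      rw [h] at this
      rw [this] at hk₂
      exact Bool.noConfusion hk₂
    refine ⟨⟨e.1, Finset.mem_erase.2 ⟨hne, e.2.1⟩, e.2.2.1, e.2.2.2⟩, he, ?_⟩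
    have hxe' := hxe
    unfold extend at hxe'
    rw [dif_neg hne] at hxe'
    exact hxe'
  · rintro ⟨e, he, hxe⟩
    exact ⟨P.liftTerm p e, he, by rw [extend_liftTerm]; exact hxe⟩

include hk₁ in
/-- `X₁` holds when the gate edge is red. -/
theorem X₁_extend_true (hpM : p ∈ P.M) (x' : (P.sub p).Term → Bool) : P.X₁ (P.extend p x' true) :=
  ⟨estar hpM hk₁, rfl, extend_estar hpM hk₁ x' true⟩

include hk₁ hk₂ in
/-- `X₁` transfers when the gate edge is blue. -/
theorem X₁_extend_false_iff (hpM : p ∈ P.M) (x' : (P.sub p).Term → Bool) :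
    P.X₁ (P.extend p x' false) ↔ (P.sub p).X₁ x' := by
  constructor
  · rintro ⟨e, he, hxe⟩
    have hne : e.1.1 ≠ p := by
      intro h
      have h' : e = estar hpM hk₁ := eq_estar_of_fst hpM hk₁ hk₂ h
      rw [h', extend_estar] at hxe
      exact Bool.noConfusion hxe
    refine ⟨⟨e.1, Finset.mem_erase.2 ⟨hne, e.2.1⟩, e.2.2.1, e.2.2.2⟩, he, ?_⟩
    have hxe' := hxe
    unfold extend at hxe'
    rw [dif_neg hne] at hxe'
    exact hxe'
  · rintro ⟨e, he, hxe⟩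
    exact ⟨P.liftTerm p e, he, by rw [extend_liftTerm]; exact hxe⟩

include hk₂ hsw in
/-- Admissibility transfers (the gate is switchable and carries a single edge). -/
theorem adm_extend_iff (x' : (P.sub p).Term → Bool) (b : Bool) :
    P.Adm (P.extend p x' b) ↔ (P.sub p).Adm x' := by
  constructor
  · rintro ⟨h1, h2⟩
    refine ⟨fun e he => ?_, fun e f hef he hf => ?_⟩
    · have := h1 (P.liftTerm p e) he
      rw [extend_liftTerm] at this
      exact this
    · have := h2 (P.liftTerm p e) (P.liftTerm p f) hef he hf
      rw [extend_liftTerm, extend_liftTerm] at this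
      exact this
  · rintro ⟨h1, h2⟩
    refine ⟨fun e he => ?_, fun e f hef he hf => ?_⟩
    · by_cases hep : e.1.1 = p
      · rw [hep] at he
        rw [he] at hsw
        exact Bool.noConfusion hsw
      · have := h1 ⟨e.1, Finset.mem_erase.2 ⟨hep, e.2.1⟩, e.2.2.1, e.2.2.2⟩ he
        unfold extend
        rw [dif_neg hep]
        exact this
    · by_cases hfp : f.1.1 = p
      · -- `f` would be a 2-edge at the gate
        exfalso
        have := f.2.2.2 hf
        rw [hfp] at this
        rw [this] at hk₂
        exact Bool.noConfusion hk₂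
      · have hep : e.1.1 ≠ p := by rw [hef]; exact hfp
        have := h2 ⟨e.1, Finset.mem_erase.2 ⟨hep, e.2.1⟩, e.2.2.1, e.2.2.2⟩
          ⟨f.1, Finset.mem_erase.2 ⟨hfp, f.2.1⟩, f.2.2.1, f.2.2.2⟩ hef he hf
        unfold extend
        rw [dif_neg hep, dif_neg hfp]
        exact this

end Transfer

end Problem

end PortProblem

end PercRepro
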